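import Mathlib
import HarnessLib
import Summits.ValiantsHypothesis.ValiantsHypothesis.Theses.MonotoneRestoration
import Literature.Computability.AlgebraicComplexity.ArithCircuit
import Literature.Computability.AlgebraicComplexity.ArithCircuitProofs
import Literature.Computability.AlgebraicComplexity.MonotoneStructure
import Literature.Computability.AlgebraicComplexity.PermanentIrreducible
import Literature.ModelTheory.FiniteModelTheory.CkEquiv
import Summits.ValiantsHypothesis.ValiantsHypothesis.Theorems.MonotoneRestorationMonotoneRestorationQPCosetCount
import Summits.ValiantsHypothesis.ValiantsHypothesis.Theorems.MonotoneRestorationMonotoneRestorationQPSymmetricLB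
import Summits.ValiantsHypothesis.ValiantsHypothesis.Theorems.MonotoneRestorationMonotoneRestorationQPSupportSymmetrisation
import Summits.ValiantsHypothesis.ValiantsHypothesis.Theorems.MonotoneRestorationMonotoneRestorationQPSparseRegime
import Summits.ValiantsHypothesis.ValiantsHypothesis.Theorems.MonotoneRestorationMonotoneRestorationQPBeta
import Literature.Computability.AlgebraicComplexity.SymmetricArithCircuit
import Literature.Computability.AlgebraicComplexity.DawarWilsenach2025Proofs
import Literature.GroupTheory.PermutationGroups.SmallIndexSubgroups
import Summits.ValiantsHypothesis.ValiantsHypothesis.Theorems.MonotoneRestorationQP.Negative.LoadBearing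
import Summits.ValiantsHypothesis.ValiantsHypothesis.Theorems.MonotoneRestorationMonotoneRestorationQPPermSupportCount

/-! TTRL-lite variant V18944 of stmt-ValiantsHypothesis-15886 -/

-- `Summit.ValiantsHypothesis.ValiantsHypothesis.…` is the tree's mandated single-conjunct layout
-- (Sub = Summit), so the duplicated namespace component is intended.
set_option linter.dupNamespace false

namespace Summit.ValiantsHypothesis.ValiantsHypothesis.Theorems

open Summit.ValiantsHypothesis.ValiantsHypothesis.Theses.MonotoneRestoration
open Literature.Computability.AlgebraicComplexity

/-- **TTRL-lite variant V18944 of `stub_mulGate_children_extend`** (key membership step): at a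
`×`-gate `P` of a circuit over `ℝ≥0`, a monomial `m` of a child `h` plus a monomial `m₀` of the
cofactor `∏_{x ∈ children P \ {h}} eval x` is a monomial of `eval P`. Factor
`eval P = eval h * ∏_{x ≠ h} eval x` (`eval_of_label_mul`, `Finset.mul_prod_erase`) and apply the
binary no-cancellation lemma `add_mem_support_mul` (nonnegative coefficients). [folklore] -/
theorem stub_mulGate_children_extend_var18944 :
    ∀ (n : ℕ) (G : Type) [DecidableEq G] (C : LabelledArithCircuit NNReal (Fin n × Fin n) Unit G)
      (P h : G) (m m₀ : (Fin n × Fin n) →₀ ℕ), C.label P = .mul → h ∈ C.children P →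
      m ∈ (C.eval h).support → m₀ ∈ (∏ x ∈ (C.children P).erase h, C.eval x).support →
      m + m₀ ∈ (C.eval P).support := by
  intro n G _ C P h m m₀ hP hh hm hm₀
  rw [C.eval_of_label_mul hP, ← Finset.mul_prod_erase (C.children P) (fun x => C.eval x) hh]
  exact add_mem_support_mul hm hm₀

end Summit.ValiantsHypothesis.ValiantsHypothesis.Theorems
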